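import Literature.NumberTheory.GaloisRepresentations.LubinTateColemanTwoVariableLimitTwo
import Literature.NumberTheory.GaloisRepresentations.LubinTateColemanTwoVariableDiagonalTwo
import HarnessLib

/-!
# Cofinal reindexing of the two-variable local tower: trace-coherent families and baseNorm-coherent families of units along
# `E₀ ≤ E₁ ≤ ⋯` ⟷ along any subtower `E_{φ(0)} ≤ E_{φ(1)} ≤ ⋯` (`φ` strictly increasing)

De Shalit, *Iwasawa theory of elliptic curves with complex multiplication* (1987), Ch. I §3.8 (16)–(17), Ch. III §1.3: the modules
`lim←_{Tr} 𝒪_{k′}` and `𝒰 = lim← 𝒰(k′·K_π^∞)` are inverse limits over the unramified layers, so they may be computed along ANY cofinal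
family of layers.  In the tree's currency a tower is `E : ℕ → IntermediateField F F̄` with `Monotone E`, and the structure theorems
(`LubinTateUnramifiedTowerIwasawa[Cyclic]`, `LubinTateColemanTwoVariableTransform[Cyclic]Two`) want the degrees to be EXACTLY `d·p^m`;
the unramified layers `K(𝔤𝔭̄^{m+1})_𝔓` of the global two-variable tower have degrees `d·p^{e_m}` with `e_m` non-decreasing, unbounded,
possibly repeating and possibly starting above `0`.  This file supplies the reindexing in both directions, for a strictly increasing
`φ : ℕ → ℕ` (so `m ≤ φ(m)` and `E ∘ φ` is cofinal in `E`):

* `unitBallTrace_add` — iterated coherence `Tr_{E_{m+j}/E_m} x_{m+j} = x_m`; `traceCoherent_comp` — restriction to the subtower `E ∘ φ`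
  preserves trace-coherence; ★★ `existsUnique_traceCoherent_extend` — **every trace-coherent family along `E ∘ φ` is the restriction of a
  UNIQUE trace-coherent family along `E`** (`x_m := Tr_{E_{φ(m)}/E_m} y_m`): `lim←_{Tr, E} 𝒪 = lim←_{Tr, E∘φ} 𝒪`;
* `baseNormCoherent_comp`, ★★ `existsUnique_baseNormCoherent_extend` — the same for baseNorm-coherent families of norm-coherent units
  `β_m ∈ 𝒰(E_m·K_π^∞)` (`RelNormCoherentUnits.baseNorm_add`, transitivity `baseNorm_baseNorm`): `𝒰_∞` along `E` = `𝒰_∞` along `E ∘ φ`;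
  `principal_extend` — the extension of a principal family is principal.

So the assembler may replace the given unramified layers by the full chain of subfields of `E_∞` of degrees `d·p^m` (`m ≥ 0`) — every
given layer is one of them and every one of them lies in a given layer — without changing `lim←_{Tr} 𝒪` or `𝒰_∞`.  Everything PROVED
(0 sorry, no named facts, no new definitions); any residue characteristic.

## References

* E. de Shalit, *Iwasawa theory of elliptic curves with complex multiplication* (1987), Ch. I §3.8 (16)–(17); Ch. III §1.3. [deShalit1987]
-/

noncomputable section

namespace Literature.NumberTheory.GaloisRepresentations

section TowerCofinal

open GaloisRepresentations.IsNonarchimedeanLocalField LubinTate ValuativeRel Field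

variable {F : Type} [Field F] [ValuativeRel F] [TopologicalSpace F] [IsNonarchimedeanLocalField F]

attribute [local instance] ltNormUniformSpace ltNormIsUniformAddGroup rk1 nF nE fintypeResidueField

variable (E : ℕ → IntermediateField F (AlgebraicClosure F)) [∀ m, FiniteDimensional F (E m)] [∀ m, IsGalois F (E m)]
  (hmono : Monotone E) {φ : ℕ → ℕ} (hφ : StrictMono φ)

/-! ### Trace-coherent families -/

/-- **Iterated trace-coherence**: `Tr_{E_{m+j}/E_m} x_{m+j} = x_m` for a family with `Tr_{E_{m+1}/E_m} x_{m+1} = x_m`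
(transitivity `unitBallTrace_unitBallTrace`). [cite: deShalit1987, Ch. I §3.8 (16)] -/
theorem unitBallTrace_add {x : ∀ m, unitBall (E m)} (hx : ∀ m, unitBallTrace (hmono (Nat.le_succ m)) (x (m + 1)) = x m) (m j : ℕ) :
    unitBallTrace (hmono (Nat.le_add_right m j)) (x (m + j)) = x m := by
  induction j with
  | zero => exact unitBallTrace_refl (x m)
  | succ j ih =>
    rw [← ih, ← hx (m + j), unitBallTrace_unitBallTrace]
    rfl

/-- **Coherence across any two comparable levels**: `Tr_{E_n/E_m} x_n = x_m` for `m ≤ n` (any proof of `E_m ≤ E_n`).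
[cite: deShalit1987, Ch. I §3.8 (16)] -/
theorem unitBallTrace_of_le {x : ∀ m, unitBall (E m)} (hx : ∀ m, unitBallTrace (hmono (Nat.le_succ m)) (x (m + 1)) = x m) {m n : ℕ}
    (hmn : m ≤ n) (h : E m ≤ E n) : unitBallTrace h (x n) = x m := by
  obtain ⟨j, rfl⟩ := Nat.exists_eq_add_of_le hmn
  exact unitBallTrace_add E hmono hx m j

include hφ in
/-- **Restriction to a subtower preserves trace-coherence**: along `E ∘ φ` (`φ` strictly increasing) the family `(x_{φ(k)})_k` is
trace-coherent. [cite: deShalit1987, Ch. I §3.8 (16)–(17)] -/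
theorem traceCoherent_comp {x : ∀ m, unitBall (E m)} (hx : ∀ m, unitBallTrace (hmono (Nat.le_succ m)) (x (m + 1)) = x m) (k : ℕ) :
    unitBallTrace (hmono (hφ.monotone (Nat.le_succ k))) (x (φ (k + 1))) = x (φ k) :=
  unitBallTrace_of_le E hmono hx (hφ.monotone (Nat.le_succ k)) _

include hφ in
/-- ★★ **Every trace-coherent family along the subtower `E ∘ φ` extends UNIQUELY to a trace-coherent family along `E`**
(`x_m := Tr_{E_{φ(m)}/E_m} y_m`, using `m ≤ φ(m)`): `lim←_{Tr}` along `E` and along `E ∘ φ` are the same module.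
[cite: deShalit1987, Ch. I §3.8 (17); Ch. III §1.3] -/
theorem existsUnique_traceCoherent_extend (y : ∀ k, unitBall (E (φ k)))
    (hy : ∀ k, unitBallTrace (hmono (hφ.monotone (Nat.le_succ k))) (y (k + 1)) = y k) :
    ∃! x : ∀ m, unitBall (E m), (∀ m, unitBallTrace (hmono (Nat.le_succ m)) (x (m + 1)) = x m) ∧ ∀ k, x (φ k) = y k := by
  have hle : ∀ m, m ≤ φ m := fun m => hφ.le_apply
  have hmono' : Monotone fun k => E (φ k) := fun a b h => hmono (hφ.monotone h)
  -- coherence of `y` across any two comparable indices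
  have hy' : ∀ {k l : ℕ} (hkl : k ≤ l), unitBallTrace (hmono (hφ.monotone hkl)) (y l) = y k := fun {k l} hkl =>
    unitBallTrace_of_le (fun k => E (φ k)) hmono' hy hkl _
  refine ⟨fun m => unitBallTrace (hmono (hle m)) (y m), ⟨fun m => ?_, fun k => ?_⟩, ?_⟩
  · -- `Tr_{m+1→m} Tr_{φ(m+1)→m+1} y_{m+1} = Tr_{φ(m+1)→m} y_{m+1} = Tr_{φ m→m} Tr_{φ(m+1)→φ m} y_{m+1} = Tr_{φ m → m} y_m`
    dsimp only
    rw [unitBallTrace_unitBallTrace, ← hy' (Nat.le_succ m), unitBallTrace_unitBallTrace]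
  · -- `Tr_{φ(φ k) → φ k} y_{φ k} = y_k`
    exact hy' (hle k)
  · rintro x ⟨hx, hxy⟩
    funext m
    rw [← hxy m]
    exact (unitBallTrace_of_le E hmono hx (hle m) _).symm

/-! ### BaseNorm-coherent families of norm-coherent units -/

variable {π : 𝒪[F]} (hπ : (valuation F).IsUniformizer (π : F))

/-- **Coherence across any two comparable levels** for units: `N_{E_n/E_m} β_n = β_m` for `m ≤ n` (any proof of `E_m ≤ E_n`;
`RelNormCoherentUnits.baseNorm_add`). [cite: deShalit1987, Ch. I §3.8 (16)] -/
theorem baseNorm_of_le {β : ∀ m, RelNormCoherentUnits hπ (E m)} (hβ : ∀ m, (β (m + 1)).baseNorm hπ (hmono (Nat.le_succ m)) = β m)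
    {m n : ℕ} (hmn : m ≤ n) (h : E m ≤ E n) : (β n).baseNorm hπ h = β m := by
  obtain ⟨j, rfl⟩ := Nat.exists_eq_add_of_le hmn
  exact RelNormCoherentUnits.baseNorm_add hπ E hmono hβ m j

include hφ in
/-- **Restriction to a subtower preserves baseNorm-coherence.** [cite: deShalit1987, Ch. I §3.8 (16)–(17)] -/
theorem baseNormCoherent_comp {β : ∀ m, RelNormCoherentUnits hπ (E m)}
    (hβ : ∀ m, (β (m + 1)).baseNorm hπ (hmono (Nat.le_succ m)) = β m) (k : ℕ) :
    (β (φ (k + 1))).baseNorm hπ (hmono (hφ.monotone (Nat.le_succ k))) = β (φ k) :=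
  baseNorm_of_le E hmono hπ hβ (hφ.monotone (Nat.le_succ k)) _

include hφ in
/-- ★★ **Every baseNorm-coherent family of norm-coherent units along the subtower `E ∘ φ` extends UNIQUELY to one along `E`**
(`β_m := N_{E_{φ(m)}/E_m} γ_m`; transitivity `baseNorm_baseNorm`): the module `𝒰_∞` of the two-variable local tower may be computed along
any cofinal chain of unramified layers. [cite: deShalit1987, Ch. I §3.8 (17); Ch. III §1.3] -/
theorem existsUnique_baseNormCoherent_extend (γ : ∀ k, RelNormCoherentUnits hπ (E (φ k)))
    (hγ : ∀ k, (γ (k + 1)).baseNorm hπ (hmono (hφ.monotone (Nat.le_succ k))) = γ k) :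
    ∃! β : ∀ m, RelNormCoherentUnits hπ (E m), (∀ m, (β (m + 1)).baseNorm hπ (hmono (Nat.le_succ m)) = β m) ∧ ∀ k, β (φ k) = γ k := by
  have hle : ∀ m, m ≤ φ m := fun m => hφ.le_apply
  have hmono' : Monotone fun k => E (φ k) := fun a b h => hmono (hφ.monotone h)
  have hγ' : ∀ {k l : ℕ} (hkl : k ≤ l), (γ l).baseNorm hπ (hmono (hφ.monotone hkl)) = γ k := fun {k l} hkl =>
    baseNorm_of_le (fun k => E (φ k)) hmono' hπ hγ hkl _
  refine ⟨fun m => (γ m).baseNorm hπ (hmono (hle m)), ⟨fun m => ?_, fun k => ?_⟩, ?_⟩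
  · dsimp only
    rw [RelNormCoherentUnits.baseNorm_baseNorm, ← hγ' (Nat.le_succ m), RelNormCoherentUnits.baseNorm_baseNorm]
  · exact hγ' (hle k)
  · rintro β ⟨hβ, hβγ⟩
    funext m
    rw [← hβγ m]
    exact (baseNorm_of_le E hmono hπ hβ (hle m) _).symm

include hφ in
/-- **The extension of a principal family is principal** (norms of principal units are principal,
`RelNormCoherentUnits.norm_val_zero_baseNorm_sub_one_lt`): if every `γ_k` is a principal unit at the bottom layer, so is every member of
the unique extension `β` of `existsUnique_baseNormCoherent_extend`. [cite: deShalit1987, Ch. I §3.8 (17)] -/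
theorem principal_extend {γ : ∀ k, RelNormCoherentUnits hπ (E (φ k))}
    (hγ1 : ∀ k, ‖(((γ k).val 0 : unitBall (E (φ k) ⊔ ltField π 0 : IntermediateField F (AlgebraicClosure F))) :
      (E (φ k) ⊔ ltField π 0 : IntermediateField F (AlgebraicClosure F))) - 1‖ < 1)
    {β : ∀ m, RelNormCoherentUnits hπ (E m)} (hβ : ∀ m, (β (m + 1)).baseNorm hπ (hmono (Nat.le_succ m)) = β m)
    (hβγ : ∀ k, β (φ k) = γ k) (m : ℕ) :
    ‖(((β m).val 0 : unitBall (E m ⊔ ltField π 0 : IntermediateField F (AlgebraicClosure F))) :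
      (E m ⊔ ltField π 0 : IntermediateField F (AlgebraicClosure F))) - 1‖ < 1 := by
  have hle : m ≤ φ m := hφ.le_apply
  rw [← baseNorm_of_le E hmono hπ hβ hle (hmono hle), hβγ m]
  exact RelNormCoherentUnits.norm_val_zero_baseNorm_sub_one_lt hπ _ (γ m) (hγ1 m)

end TowerCofinal

end Literature.NumberTheory.GaloisRepresentations
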